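import Summits.Ventures.PercRepro0.Defs
import Summits.Ventures.PercRepro0.HighDGlue

/-!
# Block H (d ≥ 11) on the cell's definitions — the Lean twin of proofs/HIGHD-p3-v3.md (seat p3)

Kernel-checked chain `T_HD ⟸ H1 + P3 + P7 + F1 + F2` on `Summit.Ventures.PercRepro0.Defs`
(p5's definitions file): every hypothesis of `THD_of_chain` is one of the route's NAMED inputs, in
the form the paper proof quotes.

* `tau_self`, `tau_symm` — (E1)/(E2) of HIGHD §0: `τ_p(x,x) = 1`, `τ_p(x,y) = τ_p(y,x)`;
* `isUpperSet_connInf` — (E4): `{x ↔ ∞}` is increasing;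
* `thetaI_sq_le_tau` — H4 · THETA-SQUARED: `θ_d(p)² ≤ τ_p(0,x)` from P3 (at `p`), P7, F1, F2;
* `T_of_triangle` — H2 + H3 · HIGH-D-ASSEMBLY (the `d`-unrestricted form R_MID-3):
  the triangle condition at `p_c(d)` forces `T d`;
* `THD_of_chain` — `T_HD` from H1 (`H1_Triangle11`) and the general inputs.

The abstract analysis (`eq_zero_of_sq_le_of_summable_triangle`, `sq_le_measure_of_inclusion`)
is imported from `HighDGlue.lean`; nothing here is a definition.
-/

namespace Summit.Ventures.PercRepro0.HighD

open MeasureTheory ProbabilityTheory unitInterval Defs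
open scoped ENNReal

/-- (E1): `x ↔ x` always, so `τ_p(x,x) = 1`. -/
theorem tau_self (d : ℕ) (p : I) (x : Vertex d) : tau d p x x = 1 := by
  unfold tau
  have h : {ω : Config d | Conn d ω x x} = Set.univ :=
    Set.eq_univ_of_forall fun _ => SimpleGraph.Reachable.refl x
  rw [h, measure_univ, ENNReal.toReal_one]

/-- (E2): `τ_p(x,y) = τ_p(y,x)` (reverse the path). -/
theorem tau_symm (d : ℕ) (p : I) (x y : Vertex d) : tau d p x y = tau d p y x := by
  unfold tau
  have h : {ω : Config d | Conn d ω x y} = {ω : Config d | Conn d ω y x} := by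
    ext ω
    exact ⟨fun hc => SimpleGraph.Reachable.symm hc, fun hc => SimpleGraph.Reachable.symm hc⟩
  rw [h]

/-- Opening more bonds enlarges the open graph. -/
theorem openGraph_mono (d : ℕ) {ω ω' : Config d} (h : ω ⊆ ω') :
    openGraph d ω ≤ openGraph d ω' := by
  unfold openGraph
  exact SimpleGraph.fromEdgeSet_mono (Set.inter_subset_inter_left _ h)

/-- (E4): connections persist when bonds are opened. -/
theorem conn_mono (d : ℕ) {ω ω' : Config d} (h : ω ⊆ ω') {x y : Vertex d}
    (hc : Conn d ω x y) : Conn d ω' x y :=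
  SimpleGraph.Reachable.mono (openGraph_mono d h) hc

/-- (E4): `{x ↔ ∞}` is an increasing event. -/
theorem isUpperSet_connInf (d : ℕ) (x : Vertex d) :
    IsUpperSet {ω : Config d | ConnInf d ω x} := by
  intro ω ω' h hω
  exact Set.Infinite.mono (fun y hy => conn_mono d h hy) hω

/-- `{0 ↔ ∞}` is an increasing event. -/
theorem isUpperSet_percolates (d : ℕ) : IsUpperSet (percolates d) :=
  isUpperSet_connInf d 0

/-- H4 · THETA-SQUARED on the cell's definitions: `θ_d(p)² ≤ τ_p(0,x)` for every `p`, `x`, from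
P3 at `p` (`P_p(U) = 1`), P7 (Harris on the two increasing events `{0 ↔ ∞}`, `{x ↔ ∞}`),
F1 (their measurability and that of `U`) and F2 (`P_p(x ↔ ∞) = P_p(0 ↔ ∞)`). -/
theorem thetaI_sq_le_tau (d : ℕ) (p : I) (x : Vertex d)
    (hP3 : P3_Unique d) (hP7 : P7_FKG d)
    (hUmeas : MeasurableSet (atMostOneInfCluster d))
    (hInfMeas : ∀ y : Vertex d, MeasurableSet {ω : Config d | ConnInf d ω y})
    (hF2 : P d p {ω | ConnInf d ω x} = P d p (percolates d)) :
    thetaI d p ^ 2 ≤ tau d p 0 x := by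
  have hU : P d p (atMostOneInfCluster d)ᶜ = 0 := by
    rw [prob_compl_eq_zero_iff hUmeas]
    exact hP3 p
  have hsub : percolates d ∩ {ω | ConnInf d ω x} ∩ atMostOneInfCluster d
      ⊆ {ω : Config d | Conn d ω 0 x} := by
    rintro ω ⟨⟨h0, hx⟩, hω⟩
    exact hω 0 x h0 hx
  have hfkg : P d p (percolates d) * P d p {ω | ConnInf d ω x}
      ≤ P d p (percolates d ∩ {ω | ConnInf d ω x}) :=
    hP7 p _ _ (isUpperSet_percolates d) (isUpperSet_connInf d x) (hInfMeas 0) (hInfMeas x)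
  have key := sq_le_measure_of_inclusion (P d p) (percolates d) {ω | ConnInf d ω x}
    (atMostOneInfCluster d) {ω | Conn d ω 0 x} hU hsub hfkg hF2
  unfold thetaI tau
  rw [← ENNReal.toReal_pow]
  exact ENNReal.toReal_mono (measure_ne_top _ _) key

/-- `ℤ^d` is infinite for `d ≥ 1`. -/
theorem infinite_vertex (d : ℕ) (hd : 1 ≤ d) : Infinite (Vertex d) :=
  Infinite.of_injective (fun n : ℤ => (fun _ : Fin d => n)) (by
    intro a b h
    have := congrFun h ⟨0, hd⟩
    simpa using this)

/-- H2 + H3 (= R_MID-3, any `d ≥ 1`): the triangle condition at `p_c(d)` forces `T d`, given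
P3, P7, F1, F2 at `p = p_c(d)`. -/
theorem T_of_triangle (d : ℕ) (hd : 1 ≤ d) (hTri : TriangleCondition d (clamp (pc d)))
    (hP3 : P3_Unique d) (hP7 : P7_FKG d)
    (hUmeas : MeasurableSet (atMostOneInfCluster d))
    (hInfMeas : ∀ y : Vertex d, MeasurableSet {ω : Config d | ConnInf d ω y})
    (hF2 : ∀ x : Vertex d,
      P d (clamp (pc d)) {ω | ConnInf d ω x} = P d (clamp (pc d)) (percolates d)) :
    T d := by
  haveI : Infinite (Vertex d) := infinite_vertex d hd
  unfold T theta
  exact eq_zero_of_sq_le_of_summable_triangle (tau d (clamp (pc d))) 0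
    (tau_self d _ 0) (fun x => tau_symm d _ x 0) hTri (thetaI d (clamp (pc d)))
    (fun x => thetaI_sq_le_tau d _ x hP3 hP7 hUmeas hInfMeas (hF2 x))

/-- T_HD ⟸ H1 · TRIANGLE-11 + P3 + P7 + F1 + F2 (the chain of HIGHD-p3-v3 §4, Corollary). -/
theorem THD_of_chain (hH1 : H1_Triangle11) (hP3 : ∀ d, P3_Unique d) (hP7 : ∀ d, P7_FKG d)
    (hUmeas : ∀ d, MeasurableSet (atMostOneInfCluster d))
    (hInfMeas : ∀ d (y : Vertex d), MeasurableSet {ω : Config d | ConnInf d ω y})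
    (hF2 : ∀ d (p : I) (x : Vertex d), P d p {ω | ConnInf d ω x} = P d p (percolates d)) :
    THD := by
  intro d hd
  exact T_of_triangle d (by omega) (hH1 d hd) (hP3 d) (hP7 d) (hUmeas d) (hInfMeas d)
    (fun x => hF2 d _ x)

end Summit.Ventures.PercRepro0.HighD
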